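import Summits.QuantumFields.YangMills.Theorems.UnitScaleTiltAvgActionDefectLoops
import Summits.QuantumFields.YangMills.Theorems.FluctuationComparisonRegPrIntLS2BetaTentKernelTorus
import Summits.QuantumFields.YangMills.Theorems.AlphaInputsT3ACv3LinearLiftSegFlat
import HarnessLib

/-!
# S2β · `hFlat` road, UV3-NODE §57.8 (C) ∕ §64.2 step (3), the (C)-STEP's kinematic half — THE CHAIN-COUPLED MEMBER WORD IS A CONJUGATE OF THE SHARP `L × L` SQUARE
# (hairpin collapse = ✓`UnitScaleTiltAvgActionDefectLoops.fourLoops_eq_conj_rect` at the chain indices), AND THE MEMBER MEAN OF ITS `dist1` IS THE TENT KERNEL APPLIED TO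
# THE FINE PLAQUETTE FUNCTION (constant ONE)

Cell `ym3-torus` (rung R3 = continuum `SU(2)` Yang–Mills on the three-torus — NOT d = 4, NOT infinite volume, NOT a mass gap, NOT Clay).
Width seat «width 10» `ym3-torus-px10` (gen 22), FREE px helper on crux `stmt-QuantumFields-20520` (`Theses.UnitScaleTilt.FluctuationComparisonRegPrIntL`),
count-neutral, DEFINITION-FREE; pen «(C)-STEP» named by px8 g21 (08:11:35Z), slot-matching table UV3-NODE §64.6 (4).

PRIOR ART (reused, not retyped).  The hairpin collapse itself is this lineage's ✓`…UnitScaleTiltAvgActionDefectLoops.fourLoops_eq_conj_rect` (ym3-torus-p1 gen 8; any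
matched orderings `σ₀ σ₁ σ₂ σ₃`): the chain coupling `i, τ i, τ i, i` (`τ (r, σ, σ′) = (r, σ′, σ)`: SWAP ∕ ID ∕ SWAP ∕ ID, px8 g21 §64.6 (4)) is its instance
`(σ₀, σ₁, σ₂, σ₃) = (σ, σ′, σ, σ′)`; the corner is `x_r = Site.blockSite y r` (✓`NE7.walkEnd_emb_stairWord`); `|Idx| = L^d·|S_d|²`, `Σ_{Idx} g(i.1) = |S_d|²·Σ_r g r`
(✓`NE7.card_idx`, ✓`NE7.sum_idx_of_fst`), `Σ_r g (blockSite y r) = Σ_{B(y)} g` (✓`LinearLiftGauge.sum_blockSite_eq`); the tent-kernel counts are px12 g23's ✓`…S2BetaTentKernelTorus`.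
* §1 ★ `chainWord_eq_conj_rect` ∕ `dist1_chainWord_eq` — the chain-coupled member word of the coarse plaquette `Q = ⟨y; μ, ν⟩` is `U(Γ^σ_{y,x_r})·rect U x_r μ ν L L·U(Γ^σ)⁻¹`,
  so its `dist1` is EXACTLY `dist1 (rect U x_r μ ν L L)` — ZERO staircase junk.
* §2 ★ `mean_idx_eq_mean_block` — MEMBER MEAN = BLOCK MEAN: `|Idx|⁻¹·Σ_i g (x_{r(i)}) = (L^d)⁻¹·Σ_{x ∈ B(y)} g x` (lit `Site.blockEquiv`).
* §3 ★ `dist1_rect_le_sum_square` (Stokes in the `(a e_μ, b e_ν)` order of the tent kernel, constant ONE), `square_injOn`, `filter_square_eq_image`, ★★ `sum_tentKernel_mul_eq` — the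
  Fubini identity `Σ_p K y p · g p = (L^d)⁻¹·Σ_{x ∈ B(y)} Σ_{a,b<L} g ⟨x + a e_μ + b e_ν; μ, ν⟩` for px12 g23's kernel written out VERBATIM; ★★★ `mean_dist1_rect_le_tentKernel` and
  ★★★ `mean_dist1_chainWord_le_tentKernel` — the (C)-STEP's MAIN TERM: `|Idx|⁻¹·Σ_i dist1 (chain word of Q at i) ≤ Σ_p K y p · dist1 U(∂p)`.

HONEST SCOPE.  Kinematics (finite sums, one `dist1_conj`); no analysis; nothing of Bałaban's renormalisation analysis is asserted; the hybrid∕coupling costs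
(✓G10∕✓G5∕✓G6), the KEY LEMMA, `hFlat`, TUBE-REG∘, GAP♯∘, S2β, crux 20520 and `YM3TorusSU2` are NOT proved; no registered stub is closed; the Yang–Mills mass gap
is NOT proved.  Sorry-free, axioms standard.
References: T. Bałaban, CMP **109** (1987) 249–301 [Balaban1987RG1] ((0.3)–(0.4) pp.252–253); CMP **98** (1985) 17–51 [Balaban1985Averaging] ((9) p.19, (19) p.21).
-/

set_option autoImplicit false

noncomputable section

namespace Summit.QuantumFields.YangMills.Theorems.FluctuationComparisonRegPrIntLS2BetaCoupledWordSquare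

open Finset
open Literature.MathematicalPhysics.QuantumFieldTheory.Balaban1983to89
open Literature.MathematicalPhysics.QuantumFieldTheory.Balaban1983to89.T4Continuum
open Literature.MathematicalPhysics.QuantumFieldTheory.Balaban1983to89.AveragingRT
open Literature.MathematicalPhysics.QuantumFieldTheory.Balaban1983to89.BlockAveraging
open B10Eq47AxialChi (shiftN shiftN_zero shiftN_succ rowProd rect rect_one_one dist1_rect_le)
open Summit.QuantumFields.YangMills.Theorems.FluctuationComparisonRegPrIntLS2BetaRowTransportVariance (shiftN_comm)
open Summit.QuantumFields.YangMills.Theorems.AvgActionDefect (fourLoops_eq_conj_rect)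
open Summit.QuantumFields.BalabanUV.T4Continuum.Spine.NE7 (card_idx card_idx_pos sum_idx_of_fst)
open Summit.QuantumFields.YangMills.Theorems.LinearLiftGauge (sum_blockSite_eq)
open Summit.QuantumFields.YangMills.Theorems.FluctuationComparisonRegPrIntLS2BetaTentKernelTorus (shiftN_apply_self shiftN_apply_ne natCast_inj_of_lt
  L_lt_sitesPerDir)

variable {P : Params} {j : ℕ} {G : Type*} [GaugeGroup G]

/-! ## §1 The chain-coupled member word is a conjugate of the sharp square -/

/-- ★ **HAIRPIN COLLAPSE AT THE CHAIN INDICES** (UV3-NODE §64.6 (4) made kernel; instance `(σ, σ′, σ, σ′)` of ✓`fourLoops_eq_conj_rect`): for the coarse plaquette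
`Q = ⟨y; μ, ν⟩` with bonds `c₁ = ⟨y, μ⟩`, `c₂ = ⟨y + e_μ, ν⟩`, `c₃ = ⟨y + e_ν, μ⟩`, `c₄ = ⟨y, ν⟩`, a member index `i = (r, σ, σ′)` and its swap `τ i = (r, σ′, σ)`, the member word at
the slots `i, τ i, τ i, i` collapses: `(ℓ₁ i·A₁)(ℓ₂ (τ i)·A₂)(ℓ₃ (τ i)·A₃)⁻¹(ℓ₄ i·A₄)⁻¹ = U(Γ^σ_{y,x_r})·rect U x_r μ ν L L·U(Γ^σ_{y,x_r})⁻¹`, `x_r = Site.blockSite y r`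
(`ℓ_m = loopHol U c_m`, `A_m = axialAvg U c_m`; standing range). [cite: Balaban1987RG1, (0.3)-(0.4) pp.252-253] -/
theorem chainWord_eq_conj_rect (hj : j + 1 ≤ P.m + P.K) (U : GaugeField P j G) (Q : Plaq P (j + 1)) (i : Idx P) :
    (loopHol U ⟨Q.src, Q.μ⟩ i * axialAvg U ⟨Q.src, Q.μ⟩) *
        (loopHol U ⟨Q.src.shift Q.μ, Q.ν⟩ (i.1, i.2.2, i.2.1) * axialAvg U ⟨Q.src.shift Q.μ, Q.ν⟩) *
        (loopHol U ⟨Q.src.shift Q.ν, Q.μ⟩ (i.1, i.2.2, i.2.1) * axialAvg U ⟨Q.src.shift Q.ν, Q.μ⟩)⁻¹ *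
        (loopHol U ⟨Q.src, Q.ν⟩ i * axialAvg U ⟨Q.src, Q.ν⟩)⁻¹ =
      holAt U (walk (emb Q.src) (stairWord i.2.1 (off i.1))) * rect U (Site.blockSite Q.src i.1) Q.μ Q.ν P.L P.L *
        (holAt U (walk (emb Q.src) (stairWord i.2.1 (off i.1))))⁻¹ :=
  fourLoops_eq_conj_rect hj U Q i.1 i.2.1 i.2.2 i.2.1 i.2.2

/-- ★ Hence the chain-coupled member word has EXACTLY the `dist1` of the sharp `L × L` square loop at the corner `x_r` — ZERO staircase junk. [cite: Balaban1985Averaging, (19) p.21] -/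
theorem dist1_chainWord_eq (hj : j + 1 ≤ P.m + P.K) (U : GaugeField P j G) (Q : Plaq P (j + 1)) (i : Idx P) :
    dist1 ((loopHol U ⟨Q.src, Q.μ⟩ i * axialAvg U ⟨Q.src, Q.μ⟩) *
        (loopHol U ⟨Q.src.shift Q.μ, Q.ν⟩ (i.1, i.2.2, i.2.1) * axialAvg U ⟨Q.src.shift Q.μ, Q.ν⟩) *
        (loopHol U ⟨Q.src.shift Q.ν, Q.μ⟩ (i.1, i.2.2, i.2.1) * axialAvg U ⟨Q.src.shift Q.ν, Q.μ⟩)⁻¹ *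
        (loopHol U ⟨Q.src, Q.ν⟩ i * axialAvg U ⟨Q.src, Q.ν⟩)⁻¹) =
      dist1 (rect U (Site.blockSite Q.src i.1) Q.μ Q.ν P.L P.L) := by
  rw [chainWord_eq_conj_rect hj, GaugeGroup.dist1_conj]

/-! ## §2 Member mean = block mean -/

/-- ★ **MEMBER MEAN = BLOCK MEAN**: `|Idx|⁻¹·Σ_i g (x_{r(i)}) = (L^d)⁻¹·Σ_{x ∈ B(y)} g x`. [cite: Balaban1987RG1, (0.4) p.253] -/
theorem mean_idx_eq_mean_block (hj : j + 1 ≤ P.m + P.K) (y : Site P (j + 1)) (g : Site P j → ℝ) :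
    ((Fintype.card (Idx P) : ℝ))⁻¹ * ∑ i : Idx P, g (Site.blockSite y i.1) = ((P.L : ℝ) ^ P.d)⁻¹ * ∑ x ∈ block y, g x := by
  rw [sum_idx_of_fst (fun r => g (Site.blockSite y r)), sum_blockSite_eq hj, card_idx]
  have hc : (0 : ℝ) < Fintype.card (Equiv.Perm (Fin P.d) × Equiv.Perm (Fin P.d)) := Nat.cast_pos.mpr Fintype.card_pos
  have hL : (0 : ℝ) < (P.L : ℝ) ^ P.d := pow_pos (Nat.cast_pos.mpr P.L_pos) _
  field_simp

/-! ## §3 Stokes in squares, the tent kernel, the (C)-STEP's main term -/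

/-- ★ **STOKES IN SQUARES in the `(a e_μ, b e_ν)` order** of the tent kernel: `dist1 (rect U x μ ν L L) ≤ Σ_{a<L} Σ_{b<L} dist1 U(∂⟨x + a e_μ + b e_ν; μ, ν⟩)` (constant ONE;
lit `dist1_rect_le` + `shiftN_comm`). [cite: Balaban1985Averaging, (19) p.21] -/
theorem dist1_rect_le_sum_square (U : GaugeField P j G) (x : Site P j) {μ ν : Fin P.d} (h : μ < ν) :
    dist1 (rect U x μ ν P.L P.L) ≤
      ∑ a ∈ range P.L, ∑ b ∈ range P.L, dist1 (GaugeField.plaqHol U ⟨shiftN (shiftN x μ a) ν b, μ, ν, h⟩) := by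
  refine (dist1_rect_le U x h P.L P.L).trans (le_of_eq ?_)
  rw [Finset.sum_comm]
  exact Finset.sum_congr rfl fun a _ => Finset.sum_congr rfl fun b _ => by rw [shiftN_comm]

/-- The `L²` plaquettes `⟨x + a e_μ + b e_ν; μ, ν⟩`, `a, b < L`, are pairwise distinct (standing range; the coordinate argument of ✓`…TentKernelTorus.card_square`). [folklore] -/
theorem square_injOn (hj : j + 1 ≤ P.m + P.K) (x : Site P j) {μ ν : Fin P.d} (h : μ < ν) :
    Set.InjOn (fun ab : ℕ × ℕ => (⟨shiftN (shiftN x μ ab.1) ν ab.2, μ, ν, h⟩ : Plaq P j)) ↑(range P.L ×ˢ range P.L) := by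
  intro ab hab ab' hab' heq
  have hN := L_lt_sitesPerDir hj
  simp only [Finset.coe_product, Set.mem_prod, Finset.mem_coe, Finset.mem_range] at hab hab'
  have hsrc : shiftN (shiftN x μ ab.1) ν ab.2 = shiftN (shiftN x μ ab'.1) ν ab'.2 := congrArg Plaq.src heq
  have hμ := congrFun hsrc μ
  have hν := congrFun hsrc ν
  rw [shiftN_apply_ne _ h.ne, shiftN_apply_ne _ h.ne, shiftN_apply_self, shiftN_apply_self] at hμ
  rw [shiftN_apply_self, shiftN_apply_self, shiftN_apply_ne _ h.ne', shiftN_apply_ne _ h.ne'] at hν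
  exact Prod.ext (natCast_inj_of_lt (hab.1.trans hN) (hab'.1.trans hN) (add_left_cancel hμ))
    (natCast_inj_of_lt (hab.2.trans hN) (hab'.2.trans hN) (add_left_cancel hν))

/-- The filled square as a filter is the image of `range L × range L`. [folklore] -/
theorem filter_square_eq_image [DecidableEq (Plaq P j)] (x : Site P j) {μ ν : Fin P.d} (h : μ < ν) :
    (Finset.univ.filter (fun p : Plaq P j => p.μ = μ ∧ p.ν = ν ∧ ∃ a ∈ range P.L, ∃ b ∈ range P.L, p.src = shiftN (shiftN x μ a) ν b)) =
      (range P.L ×ˢ range P.L).image (fun ab : ℕ × ℕ => (⟨shiftN (shiftN x μ ab.1) ν ab.2, μ, ν, h⟩ : Plaq P j)) := by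
  ext p
  simp only [Finset.mem_filter, Finset.mem_univ, true_and, Finset.mem_image, Finset.mem_product]
  constructor
  · rintro ⟨hμ, hν, a, ha, b, hb, hsrc⟩
    refine ⟨(a, b), ⟨ha, hb⟩, ?_⟩
    obtain ⟨src, pμ, pν, hp⟩ := p
    simp only at hμ hν hsrc
    subst hμ hν hsrc
    rfl
  · rintro ⟨ab, ⟨ha, hb⟩, rfl⟩
    exact ⟨rfl, rfl, ab.1, ha, ab.2, hb, rfl⟩

/-- ★★ **THE TENT KERNEL APPLIED TO A FUNCTION = THE CORNER-MEAN OF ITS SQUARE SUMS** (Fubini ∕ double counting; standing range): with px12 g23's one-level tent kernel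
(✓`…S2BetaTentKernelTorus`) written out VERBATIM, `Σ_p K y p · g p = (L^d)⁻¹ · Σ_{x ∈ B(y)} Σ_{a<L} Σ_{b<L} g ⟨x + a e_μ + b e_ν; μ, ν⟩`. [cite: Balaban1985Averaging, (19) p.21] -/
theorem sum_tentKernel_mul_eq (hj : j + 1 ≤ P.m + P.K) (y : Site P (j + 1)) {μ ν : Fin P.d} (h : μ < ν) (g : Plaq P j → ℝ) :
    ∑ p : Plaq P j, ((P.L : ℝ) ^ P.d)⁻¹ * (((block y).filter (fun x : Site P j => p.μ = μ ∧ p.ν = ν ∧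
      ∃ a ∈ range P.L, ∃ b ∈ range P.L, p.src = shiftN (shiftN x μ a) ν b)).card : ℝ) * g p =
      ((P.L : ℝ) ^ P.d)⁻¹ * ∑ x ∈ block y, ∑ a ∈ range P.L, ∑ b ∈ range P.L, g ⟨shiftN (shiftN x μ a) ν b, μ, ν, h⟩ := by
  classical
  simp only [mul_assoc, ← Finset.mul_sum]
  congr 1
  simp only [Finset.card_filter, Nat.cast_sum, Nat.cast_ite, Nat.cast_one, Nat.cast_zero, Finset.sum_mul]
  rw [Finset.sum_comm]
  refine Finset.sum_congr rfl fun x _ => ?_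
  simp only [ite_mul, one_mul, zero_mul]
  rw [← Finset.sum_filter, filter_square_eq_image x h, Finset.sum_image (square_injOn hj x h), Finset.sum_product]

/-- ★★★ **THE (C)-STEP's MAIN TERM, square form**: the member MEAN of the sharp square loops of a coarse plaquette `Q = ⟨y; μ, ν⟩` is bounded by the tent kernel applied to the
fine plaquette function, constant ONE: `|Idx|⁻¹·Σ_i dist1 (rect U x_{r(i)} μ ν L L) ≤ Σ_p K y p · dist1 U(∂p)` (standing range). [cite: Balaban1985Averaging, (19) p.21] -/
theorem mean_dist1_rect_le_tentKernel (hj : j + 1 ≤ P.m + P.K) (U : GaugeField P j G) (Q : Plaq P (j + 1)) :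
    ((Fintype.card (Idx P) : ℝ))⁻¹ * ∑ i : Idx P, dist1 (rect U (Site.blockSite Q.src i.1) Q.μ Q.ν P.L P.L) ≤
      ∑ p : Plaq P j, ((P.L : ℝ) ^ P.d)⁻¹ * (((block Q.src).filter (fun x : Site P j => p.μ = Q.μ ∧ p.ν = Q.ν ∧
        ∃ a ∈ range P.L, ∃ b ∈ range P.L, p.src = shiftN (shiftN x Q.μ a) Q.ν b)).card : ℝ) * dist1 (GaugeField.plaqHol U p) := by
  rw [mean_idx_eq_mean_block hj Q.src (fun x => dist1 (rect U x Q.μ Q.ν P.L P.L)), sum_tentKernel_mul_eq hj Q.src Q.hμν]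
  refine mul_le_mul_of_nonneg_left (Finset.sum_le_sum fun x _ => dist1_rect_le_sum_square U x Q.hμν) ?_
  exact inv_nonneg.mpr (pow_nonneg (Nat.cast_nonneg _) _)

/-- ★★★ **THE (C)-STEP's MAIN TERM, member form**: the member MEAN of `dist1` of the chain-coupled member words of `Q` is bounded by the tent kernel applied to the fine
plaquette function `dist1 U(∂·)`, constant ONE — the `Σ_b K a b·f b` slot of ✓`…KeyLemmaSkeleton.keyLemma_level`'s `hstep` (standing range). [cite: Balaban1985Averaging, (19) p.21] -/
theorem mean_dist1_chainWord_le_tentKernel (hj : j + 1 ≤ P.m + P.K) (U : GaugeField P j G) (Q : Plaq P (j + 1)) :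
    ((Fintype.card (Idx P) : ℝ))⁻¹ * ∑ i : Idx P, dist1 ((loopHol U ⟨Q.src, Q.μ⟩ i * axialAvg U ⟨Q.src, Q.μ⟩) *
        (loopHol U ⟨Q.src.shift Q.μ, Q.ν⟩ (i.1, i.2.2, i.2.1) * axialAvg U ⟨Q.src.shift Q.μ, Q.ν⟩) *
        (loopHol U ⟨Q.src.shift Q.ν, Q.μ⟩ (i.1, i.2.2, i.2.1) * axialAvg U ⟨Q.src.shift Q.ν, Q.μ⟩)⁻¹ *
        (loopHol U ⟨Q.src, Q.ν⟩ i * axialAvg U ⟨Q.src, Q.ν⟩)⁻¹) ≤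
      ∑ p : Plaq P j, ((P.L : ℝ) ^ P.d)⁻¹ * (((block Q.src).filter (fun x : Site P j => p.μ = Q.μ ∧ p.ν = Q.ν ∧
        ∃ a ∈ range P.L, ∃ b ∈ range P.L, p.src = shiftN (shiftN x Q.μ a) Q.ν b)).card : ℝ) * dist1 (GaugeField.plaqHol U p) := by
  simp only [dist1_chainWord_eq hj]
  exact mean_dist1_rect_le_tentKernel hj U Q

end Summit.QuantumFields.YangMills.Theorems.FluctuationComparisonRegPrIntLS2BetaCoupledWordSquare

end
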